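import Literature.MathematicalPhysics.QuantumFieldTheory.Balaban1983to89.B9Thm311SymmAtRecordV4

/-!
# `Balaban1983to89.B9Thm311DeltaPrimePos` — [B9] Theorem 3.11's FIRST operator at def-Y's v4 letters: `Δ′_a(U)` IS POSITIVE DEFINITE for EVERY
# unitary-valued background — (3.24)'s quadratic form as a sum of squares and the transport of flat sections along def-Y's contours (part 1 of 2;
# part 2 `B9Thm311PosAtRecordV4` re-derives row 17 of the N06 knit with the clause `pos0` discharged)

T. Bałaban, *Propagators for lattice gauge theories in a background field*, Commun. Math. Phys. **99** (1985) 389–434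
[`Balaban1985BackgroundPropagators`, "B9"]; [4] = *Propagators … II*, Commun. Math. Phys. **96** (1984) 223–250 [`Balaban1984PropagatorsII`].

statement-level skeleton of published theorems with citation tags; proofs where landed; nothing here is a claim about the
Yang–Mills mass gap

THE PRINTED LOCI (verbatim).  p. 394, (3.24): *"Δ′_a = Δ′_a(U) = (Δ^η_U + Q′\*aQ′)|_{Ω₀}, where … ⟨λ, Q′\*aQ′λ⟩ = Σ_{j=0}^{k} a_j Σ_{y∈Λ_j} (L^jη)^{d−2}
|(Q′_j(U)λ)(y)|²"*;  pp. 394–395: *"Assuming some regularity of the configuration U it can be easily shown that the operator Δ′_a is positive. This implies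
positivity of the operators G′, Q′G′²Q′\*"*;  p. 416, Theorem 3.11: *"the operators Δ′_a, G′, (Q′G′²Q′\*)⁻¹, Δ_a, G are positive definite. This is obvious
for the first three operators"*;  (3.23) p. 395 (`⟨λ, Δ_Uλ⟩ = ‖∇_Uλ‖²`);  (3.19) p. 393 (`(Q′_j(U)λ)(y) = Σ_{x∈B^j(y)} L^{−jd} R(U(Γ_{y,x}))λ(x)`);  (3.40) p. 397.

WHY THIS FILE (own audit R8 of seat n06-j, gen 7).  Row 17 of the N06 knit at def-Y's v4 record (`B9Thm311SymmAtRecordV4.t311_of_pins_opsYOfRecordV4E₅`)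
displays FIVE printed-shape clauses `Inputs311Y₅` = {`pos0`, `unitA`, `posG0`, `fac`, `small`}.  The first, `pos0 : PosDefTr 1 (deltaPrimeAY x.toKIdx parS U)`,
is NOT analytic: it holds for EVERY unitary-valued `U` (no smallness, no `M`) at def-Y's GENUINE letter `deltaPrimeAY i par U = lapSL i U + kernelTrOpY
(avgCoeffY i) (avgTrY i par U)` over the inverse-symmetric table `par = parSymY` of the v4 record, by the argument print calls *"easily shown"*:
  `⟨Φ, Δ′_a(U)Φ⟩₁ = Σ_μ ‖∇_{U,μ}Φ‖²₁ + Σ_{s∈𝔅} levC_s · ‖Σ_{z∈s} R(U(Γ_{c_s,z}))Φ(z)‖²_F`   (`trIP_deltaPrimeAY_eq`; `c_s` the corner of the block `s`, `levC_s =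
  a_j L^{−2j} L^{−j(d+1)} > 0`, the inner sum `= W_s·(Q′(U)Φ)(s)` — (3.24) up to units; tools: unitary conjugation is a Frobenius isometry, and (3.8)),
hence `≥ 0`, and `= 0` forces `∇_UΦ = 0` and every transported block sum to vanish; a covariantly constant Φ is TRANSPORTED by def-Y's taxicab contour
variables (`R(U(Γ_{x,x′}))Φ(x′) = Φ(x)`, §1: induction along `Node00.OpsYTransport.parFwdV ∕ parBwdV ∕ taxiLegV ∕ taxiRun`, then the chart and the
symmetrisation), so each block sum is `|s|·Φ(c_s)`, whence `Φ(c_s) = 0` at every corner and `Φ ≡ 0`.  PRIOR ART at other letters (same method, other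
carriers, not importable here): the pub-balaban NE9 chain's `B9Thm311DeltaPrimeA.laplacePrimeA_pos` over `B9Eq323Ker.kernel_of_flat_of_avgQ`.

* §1 (torus `Site P 0`, any ring) transport of FLAT sections: `R_parFwdV_of_flat`, `R_parBwdV_of_flat`, `R_taxiLegV_of_flat`, `R_taxiRun_of_flat`,
  ★ `R_parTaxiV_of_flat`; at an index: `flat_of_cdS_eq_zero` (∇_UΦ = 0 read through the chart `boxEquiv`), ★ `R_parSY_of_cdS_eq_zero`, ★ `R_parSymY_of_cdS_eq_zero`.
* §2 (𝔸 = M_N(ℂ)) the two halves of (3.24)'s form: `trIP_self_nonneg ∕ _pos`, `re_trace_conjTranspose_mul_self_eq_trIP ∕ _nonneg`,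
  `eq_zero_of_re_trace_conjTranspose_mul_self_eq_zero`, `trIP_add_right`, ★ `trIP_lapSL_eq` (`⟨Φ, Δ_UΦ⟩₁ = Σ_μ‖∇_μΦ‖²₁`), `crnTrY`, `blkSumY`
  (`Σ_{z∈s} R(U(Γ_{c_s,z}))Φ(z)`), `blkSumY_eq_smul_QpY` (`= W_s • (Q′(U)Φ)(s)`), `avgCoeffY_mul_re_trace_eq`, `trIP_kernelTrOpY_eq_sum_sum`,
  ★ `trIP_kernelTrOpY_eq_sum_blk` (the block-square identity), `one_le_level`, `levC_blk_pos`, ★ `trIP_deltaPrimeAY_eq` ((3.24) as printed).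
* §3 ★★ `deltaPrimeAY_posDefTr_of_flat_transport` (generic inverse-symmetric `G`-valued table transporting flat sections, `G ≤ U(N)`),
  ★★★ `deltaPrimeAY_parSymY_posDefTr` (def-Y's v4 letter, EVERY `G`-valued `U`), `isUnit_deltaPrimeAY_parSymY` (Δ′_a(U) invertible — `GpY` IS its inverse),
  `posDefTr_ringInverse`, ★ `GpY_parSymY_posDefTr` (Thm 3.11's SECOND operator `G′(U) = Δ′_a(U)⁻¹ > 0`).

HONEST SCOPE.  Finite-dimensional non-commutative algebra and an induction along def-Y's contour construction; no estimate of [B9] is proved or asserted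
(no uniform bound, no decay — Theorems 3.1–3.10 untouched); the qualitative positivity print calls obvious becomes a theorem at the letters of record.
NOT a node discharge, NOT summit progress; count-neutral; nothing continuum, nothing about the mass gap.  Cell `pub-ymgap` (HUMAN RULING D-0062), Track A
node N06 [B9], seat `pub-ymgap-dag-n06-j` (harness re-seat gen 7), 2026-08-27.
-/

namespace Literature.MathematicalPhysics.QuantumFieldTheory.Balaban1983to89.B9Thm311DeltaPrimePos

open Literature.MathematicalPhysics.QuantumFieldTheory.Balaban1983to89
open B9Thm311Whole B9Thm311ReadingCoords B9Thm311ReadingAtLetters B9Thm311AdjointAtLetters B9Thm311DeltaPrimeSymm B9Thm311InputsAtOne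
  B9Thm311AdjointPairs B9Ineq349SiteAdjoint B9Thm311Curv2Symm B9Thm311SymmAtRecordV4 Node00
open B6KLevelCensusIndexV1 B6Geom246MultiLevelBox B6MultiLevelBoxOperator B9PinMembersKLevelV1 B9PinGeometryKLevelV1 B7Prop2SpecialUnitary
open B6GlobalChartV1 B9BackgroundsKLevelV1 B9Eq39Adjoint
open scoped Matrix

noncomputable section

/-! ## §1 Transport of flat (covariantly constant) sections along def-Y's contours -/

section Torus

variable {P : Params} {𝔸 : Type} [Ring 𝔸]

/-- `(x − e_μ) + e_μ = x` on the torus. [cite: Balaban1985BackgroundPropagators, (3.3) p.391, bookkeeping] -/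
private theorem shift_unshift' {j : ℕ} (x : Site P j) (μ : Fin P.d) : (x.unshift μ).shift μ = x := by
  funext ν
  by_cases h : ν = μ
  · subst h; simp [Site.shift, Site.unshift]
  · simp [Site.shift, Site.unshift, Function.update_of_ne h]

/-- a FLAT section (`Φ(y) = R(U_μ(y))Φ(y + e_μ)` on every bond, i.e. `∇_UΦ = 0`) is transported by the forward straight contour variable:
`R(U(Γ))Φ(y + n e_μ) = Φ(y)`. [cite: Balaban1985BackgroundPropagators, (3.3) p.391, (3.40) p.397] -/
theorem R_parFwdV_of_flat {U : CfgV1 P 𝔸} {Φ : Site P 0 → 𝔸} (hΦ : ∀ μ y, Φ y = R (U μ y) (Φ (y.shift μ))) (μ : Fin P.d) :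
    ∀ (n : ℕ) (y : Site P 0), R (parFwdV U μ n y) (Φ ((fun w : Site P 0 => w.shift μ)^[n] y)) = Φ y
  | 0, y => by simp
  | n + 1, y => by
    rw [parFwdV_succ, B9Eq39Adjoint.R_mul, Function.iterate_succ_apply, R_parFwdV_of_flat hΦ μ n (y.shift μ), ← hΦ]

/-- … and by the backward straight contour variable: `R(U(Γ))Φ(y − n e_μ) = Φ(y)`. [cite: Balaban1985BackgroundPropagators, (3.3), (3.5) p.391, (3.40) p.397] -/
theorem R_parBwdV_of_flat {U : CfgV1 P 𝔸} {Φ : Site P 0 → 𝔸} (hΦ : ∀ μ y, Φ y = R (U μ y) (Φ (y.shift μ))) (μ : Fin P.d) :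
    ∀ (n : ℕ) (y : Site P 0), R (parBwdV U μ n y) (Φ ((fun w : Site P 0 => w.unshift μ)^[n] y)) = Φ y
  | 0, y => by simp
  | n + 1, y => by
    rw [parBwdV_succ, B9Eq39Adjoint.R_mul, Function.iterate_succ_apply, R_parBwdV_of_flat hΦ μ n (y.unshift μ), hΦ μ (y.unshift μ), shift_unshift',
      R_inv_R]

/-- one taxicab leg keeps the invariant `R(accumulated transporter)Φ(endpoint) = Φ(start)`. [cite: Balaban1985BackgroundPropagators, (3.40) p.397] -/
theorem R_taxiLegV_of_flat {U : CfgV1 P 𝔸} {Φ : Site P 0 → 𝔸} (hΦ : ∀ μ y, Φ y = R (U μ y) (Φ (y.shift μ))) (x' x : Site P 0)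
    (s : Site P 0 × 𝔸ˣ) (hs : R s.2 (Φ s.1) = Φ x) (μ : Fin P.d) :
    R (taxiLegV U x' s μ).2 (Φ (taxiLegV U x' s μ).1) = Φ x := by
  unfold taxiLegV
  split_ifs
  · dsimp only; rw [B9Eq39Adjoint.R_mul, R_parFwdV_of_flat hΦ, hs]
  · dsimp only; rw [B9Eq39Adjoint.R_mul, R_parBwdV_of_flat hΦ, hs]

/-- a run of legs keeps the invariant. [cite: Balaban1985BackgroundPropagators, (3.40) p.397] -/
theorem R_taxiRun_of_flat {U : CfgV1 P 𝔸} {Φ : Site P 0 → 𝔸} (hΦ : ∀ μ y, Φ y = R (U μ y) (Φ (y.shift μ))) (x' x : Site P 0) :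
    ∀ (l : List (Fin P.d)) (s : Site P 0 × 𝔸ˣ), R s.2 (Φ s.1) = Φ x → R (taxiRun U x' l s).2 (Φ (taxiRun U x' l s).1) = Φ x
  | [], _, hs => hs
  | μ :: l, s, hs => R_taxiRun_of_flat hΦ x' x l (taxiLegV U x' s μ) (R_taxiLegV_of_flat hΦ x' x s hs μ)

/-- ★ **A FLAT SECTION IS TRANSPORTED BY THE TAXICAB CONTOUR VARIABLE**: `∇_UΦ = 0 ⇒ R(U(Γ_{x,x′}))Φ(x′) = Φ(x)` for def-Y's `parTaxiV`.
[cite: Balaban1985BackgroundPropagators, (3.3) p.391, (3.40) p.397] -/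
theorem R_parTaxiV_of_flat {U : CfgV1 P 𝔸} {Φ : Site P 0 → 𝔸} (hΦ : ∀ μ y, Φ y = R (U μ y) (Φ (y.shift μ))) (x x' : Site P 0) :
    R (parTaxiV U x x') (Φ x') = Φ x := by
  have h := R_taxiRun_of_flat hΦ x' x (List.finRange P.d) (x, 1) (by simp)
  rwa [show (taxiRun U x' (List.finRange P.d) (x, 1)).1 = x' from taxiEnd_eq U x x'] at h

end Torus

section IndexTransport

variable {d ℓ : ℕ} {hd : 1 ≤ d + 1} {hL : Odd (ℓ + 1) ∧ 1 < ℓ + 1} {b₀ b₁ : ℝ}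
variable {𝔸 : Type} [NormedRing 𝔸] [NormedAlgebra ℂ 𝔸] [CompleteSpace 𝔸]
variable (i : KIdx d ℓ hd hL b₀ b₁)

/-- `∇_UΦ = 0` on the box chart says: `Φ ∘ boxEquiv` is a flat section of the torus. [cite: Balaban1985BackgroundPropagators, (3.3) p.391] -/
theorem flat_of_cdS_eq_zero (U : CfgY 𝔸 i) {Φ : SiteY i → 𝔸} (hΦ : ∀ μ, cdS i U μ Φ = 0) (μ : Fin (d + 1))
    (y : Site (PV d ℓ i.m i.K hd hL) 0) : Φ (boxEquiv i.hN y) = R (U μ y) (Φ (boxEquiv i.hN (y.shift μ))) := by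
  have h : cdS i U μ Φ (boxEquiv i.hN y) = 0 := by rw [hΦ μ]; rfl
  simp only [cdS, B9Eq39Adjoint.covD, UboxY, sub_eq_zero, Equiv.symm_apply_apply] at h
  have hs : shiftY i μ (boxEquiv i.hN y) = boxEquiv i.hN (y.shift μ) := by
    rw [← Equiv.apply_symm_apply (boxEquiv i.hN) (shiftY i μ (boxEquiv i.hN y)), boxEquiv_symm_shiftY, Equiv.symm_apply_apply]
  rw [hs] at h
  exact h.symm

/-- ★ **def-Y's TAXICAB SITE TRANSPORTER TRANSPORTS FLAT SECTIONS**: `∇_UΦ = 0 ⇒ R(U(Γ_{z,w}))Φ(w) = Φ(z)` for `parSY`.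
[cite: Balaban1985BackgroundPropagators, (3.3) p.391, (3.40) p.397] -/
theorem R_parSY_of_cdS_eq_zero (U : CfgY 𝔸 i) {Φ : SiteY i → 𝔸} (hΦ : ∀ μ, cdS i U μ Φ = 0) (z w : SiteY i) :
    R (parSY i U z w) (Φ w) = Φ z := by
  have hflat : ∀ μ y, (Φ ∘ boxEquiv i.hN) y = R (U μ y) ((Φ ∘ boxEquiv i.hN) (y.shift μ)) := fun μ y =>
    flat_of_cdS_eq_zero i U hΦ μ y
  have h := R_parTaxiV_of_flat hflat ((boxEquiv i.hN).symm z) ((boxEquiv i.hN).symm w)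
  simp only [Function.comp_apply, Equiv.apply_symm_apply] at h
  exact h

/-- ★ the same for the v4 record's SYMMETRISED transporter `parSymY` (either branch: a contour variable or the inverse of the reversed one).
[cite: Balaban1985BackgroundPropagators, (3.3), (3.5) p.391, (3.40) p.397] -/
theorem R_parSymY_of_cdS_eq_zero (U : CfgY 𝔸 i) {Φ : SiteY i → 𝔸} (hΦ : ∀ μ, cdS i U μ Φ = 0) (z w : SiteY i) :
    R (parSymY i U z w) (Φ w) = Φ z := by
  by_cases h : toLex z.1 ≤ toLex w.1
  · rw [parSymY_of_le h]; exact R_parSY_of_cdS_eq_zero i U hΦ z w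
  · rw [parSymY_of_not_le h, ← R_parSY_of_cdS_eq_zero i U hΦ w z, R_inv_R]

end IndexTransport

/-! ## §2 The two halves of (3.24)'s quadratic form at `𝔸 = M_N(ℂ)` -/

section Forms

open scoped Matrix.Norms.L2Operator

variable {N : ℕ} {S : Type} [Fintype S]

/-- `⟨Φ, Φ⟩_w ≥ 0`. [cite: Balaban1985BackgroundPropagators, p.393 (scalar products), bookkeeping] -/
theorem trIP_self_nonneg (w : S → ℝ) (hw : ∀ s, 0 < w s) (Φ : S → Matrix (Fin N) (Fin N) ℂ) : 0 ≤ trIP w Φ Φ := by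
  rw [← norm_sq_realify311 (hw := hw)]; exact sq_nonneg _

/-- `⟨Φ, Φ⟩_w > 0` for `Φ ≠ 0`. [cite: Balaban1985BackgroundPropagators, p.393 (scalar products), bookkeeping] -/
theorem trIP_self_pos (w : S → ℝ) (hw : ∀ s, 0 < w s) {Φ : S → Matrix (Fin N) (Fin N) ℂ} (hΦ : Φ ≠ 0) : 0 < trIP w Φ Φ := by
  rw [← norm_sq_realify311 (hw := hw)]
  exact pow_pos (norm_pos_iff.2 fun h => hΦ ((realify311 w hw).map_eq_zero_iff.1 h)) 2

/-- `Re tr(A\*A)` as the trace pairing of the one-point function `A`. [cite: Balaban1985BackgroundPropagators, p.392 (X·Y = tr XY), bookkeeping] -/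
theorem re_trace_conjTranspose_mul_self_eq_trIP (A : Matrix (Fin N) (Fin N) ℂ) :
    (Matrix.trace (Aᴴ * A)).re = trIP (fun _ : Unit => (1 : ℝ)) (fun _ => A) (fun _ => A) := by
  rw [trIP_one_eq, Fintype.sum_unique]

/-- `Re tr(A\*A) ≥ 0` (the Frobenius norm squared). [cite: Balaban1985BackgroundPropagators, p.392 (X·Y = tr XY), bookkeeping] -/
theorem re_trace_conjTranspose_mul_self_nonneg (A : Matrix (Fin N) (Fin N) ℂ) : 0 ≤ (Matrix.trace (Aᴴ * A)).re := by
  rw [re_trace_conjTranspose_mul_self_eq_trIP]; exact trIP_self_nonneg _ (fun _ => one_pos) _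

/-- `Re tr(A\*A) = 0 ⇒ A = 0`. [cite: Balaban1985BackgroundPropagators, p.392 (X·Y = tr XY), bookkeeping] -/
theorem eq_zero_of_re_trace_conjTranspose_mul_self_eq_zero {A : Matrix (Fin N) (Fin N) ℂ} (h : (Matrix.trace (Aᴴ * A)).re = 0) : A = 0 := by
  by_contra hA
  have hp := trIP_self_pos (fun _ : Unit => (1 : ℝ)) (fun _ => one_pos) (Φ := fun _ => A) fun h0 => hA (congrFun h0 ())
  rw [← re_trace_conjTranspose_mul_self_eq_trIP, h] at hp
  exact lt_irrefl _ hp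

/-- the pairing is additive on the right. [cite: Balaban1985BackgroundPropagators, p.393 (scalar products), bookkeeping] -/
theorem trIP_add_right (w : S → ℝ) (Φ Ψ₁ Ψ₂ : S → Matrix (Fin N) (Fin N) ℂ) : trIP w Φ (Ψ₁ + Ψ₂) = trIP w Φ Ψ₁ + trIP w Φ Ψ₂ := by
  simp only [trIP, Pi.add_apply, Matrix.add_apply, mul_add, Complex.add_re, Finset.sum_add_distrib]

variable {d ℓ : ℕ} {hd : 1 ≤ d + 1} {hL : Odd (ℓ + 1) ∧ 1 < ℓ + 1} {b₀ b₁ : ℝ}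
variable (i : KIdx d ℓ hd hL b₀ b₁)

/-- ★ **(3.23): `⟨Φ, Δ_UΦ⟩₁ = Σ_μ ‖∇_{U,μ}Φ‖²₁`** at a unitary-valued configuration. [cite: Balaban1985BackgroundPropagators, (3.23) p.395, (3.8) p.392] -/
theorem trIP_lapSL_eq (U : CfgY (Matrix (Fin N) (Fin N) ℂ) i)
    (hU : ∀ μ x, ((U μ x : (Matrix (Fin N) (Fin N) ℂ)ˣ) : Matrix (Fin N) (Fin N) ℂ) ∈ unitary (Matrix (Fin N) (Fin N) ℂ))
    (Φ : SiteY i → Matrix (Fin N) (Fin N) ℂ) :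
    trIP (fun _ => (1 : ℝ)) Φ (lapSL i U Φ) = ∑ μ : Fin (d + 1), trIP (fun _ => (1 : ℝ)) (cdS i U μ Φ) (cdS i U μ Φ) := by
  rw [trIP_one_eq, lapSL_apply, sum_trace_mul_lapS i U hU Φ Φ, Complex.re_sum]
  exact Finset.sum_congr rfl fun μ _ => (trIP_one_eq _ _).symm

/-- `Φ` READ IN THE FRAME OF ITS BLOCK'S CORNER: `z ↦ R(U(Γ_{c(z),z}))Φ(z)`, `c(z)` the corner of the block of `𝔅` containing `z` (the transport
inside (3.19)'s `Q′_j(U)`). [cite: Balaban1985BackgroundPropagators, (3.19) p.393, dictionary] -/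
def crnTrY (par : SiteParY (Matrix (Fin N) (Fin N) ℂ) i) (U : CfgY (Matrix (Fin N) (Fin N) ℂ) i) (Φ : SiteY i → Matrix (Fin N) (Fin N) ℂ) :
    SiteY i → Matrix (Fin N) (Fin N) ℂ :=
  fun z => R (par U (blkCornerY i (blkOf i.D.toDomains z)) z) (Φ z)

/-- the TRANSPORTED BLOCK SUM `Σ_{z∈s} R(U(Γ_{c_s,z}))Φ(z)` of a block `s ∈ 𝔅` (`= W_s·(Q′(U)Φ)(s)`, `blkSumY_eq_smul_QpY`).
[cite: Balaban1985BackgroundPropagators, (3.19) p.393, dictionary] -/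
def blkSumY (par : SiteParY (Matrix (Fin N) (Fin N) ℂ) i) (U : CfgY (Matrix (Fin N) (Fin N) ℂ) i) (Φ : SiteY i → Matrix (Fin N) (Fin N) ℂ)
    (s : BlkY i) : Matrix (Fin N) (Fin N) ℂ :=
  ∑ z ∈ Finset.univ.filter (fun z : SiteY i => blkOf i.D.toDomains z = s), R (par U (blkCornerY i s) z) (Φ z)

/-- the block sum IS the block volume times def-Y's covariant block average: `Σ_{z∈s} R(U(Γ_{c_s,z}))Φ(z) = W_s • (Q′(U)Φ)(s)`.
[cite: Balaban1985BackgroundPropagators, (3.19) p.393; Balaban1984PropagatorsII, (2.16)–(2.17) p.225] -/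
theorem blkSumY_eq_smul_QpY (par : SiteParY (Matrix (Fin N) (Fin N) ℂ) i) (U : CfgY (Matrix (Fin N) (Fin N) ℂ) i)
    (Φ : SiteY i → Matrix (Fin N) (Fin N) ℂ) (s : BlkY i) : blkSumY i par U Φ s = ((wB i s : ℝ) : ℂ) • QpY i par U Φ s := by
  have hq : ∀ z : SiteY i, qpK i s z = if blkOf i.D.toDomains z = s then (wB i s)⁻¹ else 0 := fun _ => rfl
  rw [QpY, trLiftY_apply, Finset.smul_sum, blkSumY, Finset.sum_filter]
  refine Finset.sum_congr rfl fun z _ => ?_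
  rw [hq z]
  split_ifs
  · rw [smul_smul, ← Complex.ofReal_mul, mul_inv_cancel₀ (wB_pos i s).ne', Complex.ofReal_one, one_smul]
    rfl
  · rw [Complex.ofReal_zero, zero_smul, smul_zero]

variable {G : Subgroup (Matrix (Fin N) (Fin N) ℂ)ˣ}

/-- ONE TERM OF THE AVERAGING FORM on an inverse-symmetric `G`-valued table, `G ≤ U(N)`: `a(z,w)·Re tr(Φ(z)\* R(U(Γ_{z,c})U(Γ_{c,w}))Φ(w))
= a(z,w)·Re tr((R(U(Γ_{c,z}))Φ(z))\* R(U(Γ_{c,w}))Φ(w))` — conjugation by the unitary `U(Γ_{c,z})` is a Frobenius isometry.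
[cite: Balaban1985BackgroundPropagators, (3.19) p.393, (3.24) p.394] -/
theorem avgCoeffY_mul_re_trace_eq (hG : G ≤ B7Prop2Explicit.unitaryUnits (Matrix (Fin N) (Fin N) ℂ))
    (par : SiteParY (Matrix (Fin N) (Fin N) ℂ) i) (U : CfgY (Matrix (Fin N) (Fin N) ℂ) i) (hinv : ∀ z z' : SiteY i, par U z z' = (par U z' z)⁻¹)
    (hpar : ∀ z w : SiteY i, par U z w ∈ G) (Φ : SiteY i → Matrix (Fin N) (Fin N) ℂ) (z w : SiteY i) :
    avgCoeffY i z w * (Matrix.trace ((Φ z)ᴴ * R (avgTrY i par U z w) (Φ w))).re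
      = avgCoeffY i z w * (Matrix.trace ((crnTrY i par U Φ z)ᴴ * crnTrY i par U Φ w)).re := by
  by_cases h0 : avgCoeffY i z w = 0
  · rw [h0, zero_mul, zero_mul]
  · have hc : blkOf i.D.toDomains w = blkOf i.D.toDomains z := by
      rw [avgCoeffY_eq_ite] at h0; by_contra hne; exact h0 (if_neg hne)
    simp only [crnTrY]
    rw [hc, avgTrY, cornerY_levY_eq i z, hinv z (blkCornerY i (blkOf i.D.toDomains z)), B9Eq39Adjoint.R_mul,
      ← trace_conjTranspose_R_mul (par U (blkCornerY i (blkOf i.D.toDomains z)) z) (hG (hpar _ _))]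

/-- the averaging form as a double sum of corner-frame pairings. [cite: Balaban1985BackgroundPropagators, (3.24) p.394, bookkeeping] -/
theorem trIP_kernelTrOpY_eq_sum_sum (hG : G ≤ B7Prop2Explicit.unitaryUnits (Matrix (Fin N) (Fin N) ℂ))
    (par : SiteParY (Matrix (Fin N) (Fin N) ℂ) i) (U : CfgY (Matrix (Fin N) (Fin N) ℂ) i) (hinv : ∀ z z' : SiteY i, par U z z' = (par U z' z)⁻¹)
    (hpar : ∀ z w : SiteY i, par U z w ∈ G) (Φ : SiteY i → Matrix (Fin N) (Fin N) ℂ) :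
    trIP (fun _ => (1 : ℝ)) Φ (kernelTrOpY (avgCoeffY i) (avgTrY i par U) Φ)
      = ∑ z, ∑ w, avgCoeffY i z w * (Matrix.trace ((crnTrY i par U Φ z)ᴴ * crnTrY i par U Φ w)).re := by
  rw [trIP_one_eq, Complex.re_sum]
  refine Finset.sum_congr rfl fun z _ => ?_
  rw [kernelTrOpY_eq_trLiftY, re_trace_conjTranspose_mul_trLiftY]
  refine Finset.sum_congr rfl fun w _ => ?_
  rw [Matrix.of_apply]
  exact avgCoeffY_mul_re_trace_eq i hG par U hinv hpar Φ z w

/-- ★ **THE BLOCK-SQUARE IDENTITY**: on an inverse-symmetric `G`-valued table (`G ≤ U(N)`) the averaging form of (3.24) is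
`Σ_{s∈𝔅} levC_s · Re tr((Σ_{z∈s}R(U(Γ_{c_s,z}))Φ(z))\* (Σ_{z∈s}R(U(Γ_{c_s,z}))Φ(z)))` — print's `Σ_j a_j Σ_y (L^jη)^{d−2}|(Q′_j(U)Φ)(y)|²`.
[cite: Balaban1985BackgroundPropagators, (3.24) p.394; Balaban1984PropagatorsII, (2.14) p.225] -/
theorem trIP_kernelTrOpY_eq_sum_blk (hG : G ≤ B7Prop2Explicit.unitaryUnits (Matrix (Fin N) (Fin N) ℂ))
    (par : SiteParY (Matrix (Fin N) (Fin N) ℂ) i) (U : CfgY (Matrix (Fin N) (Fin N) ℂ) i) (hinv : ∀ z z' : SiteY i, par U z z' = (par U z' z)⁻¹)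
    (hpar : ∀ z w : SiteY i, par U z w ∈ G) (Φ : SiteY i → Matrix (Fin N) (Fin N) ℂ) :
    trIP (fun _ => (1 : ℝ)) Φ (kernelTrOpY (avgCoeffY i) (avgTrY i par U) Φ)
      = ∑ s : BlkY i, levC d ℓ (aPrinted ℓ 1) s.1.1 * (Matrix.trace ((blkSumY i par U Φ s)ᴴ * blkSumY i par U Φ s)).re := by
  rw [trIP_kernelTrOpY_eq_sum_sum i hG par U hinv hpar Φ]
  refine (Finset.sum_fiberwise Finset.univ (fun z : SiteY i => blkOf i.D.toDomains z) _).symm.trans ?_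
  refine Finset.sum_congr rfl fun s _ => ?_
  have hmem : ∀ {z : SiteY i}, z ∈ Finset.univ.filter (fun z : SiteY i => blkOf i.D.toDomains z = s) ↔ blkOf i.D.toDomains z = s :=
    fun {z} => by rw [Finset.mem_filter, and_iff_right (Finset.mem_univ z)]
  calc ∑ z ∈ Finset.univ.filter (fun z : SiteY i => blkOf i.D.toDomains z = s),
        ∑ w, avgCoeffY i z w * (Matrix.trace ((crnTrY i par U Φ z)ᴴ * crnTrY i par U Φ w)).re
      = ∑ z ∈ Finset.univ.filter (fun z : SiteY i => blkOf i.D.toDomains z = s),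
          levC d ℓ (aPrinted ℓ 1) s.1.1 * ∑ w ∈ Finset.univ.filter (fun w : SiteY i => blkOf i.D.toDomains w = s),
            (Matrix.trace ((crnTrY i par U Φ z)ᴴ * crnTrY i par U Φ w)).re := by
        refine Finset.sum_congr rfl fun z hz => ?_
        have hzs : blkOf i.D.toDomains z = s := hmem.1 hz
        have hlev : levY i z = s.1.1 := by
          change i.D.toDomains.lev z.1 = s.1.1
          exact lev_eq_of_blkOf_eq i.D.toDomains hzs
        rw [Finset.sum_filter, Finset.mul_sum]
        refine Finset.sum_congr rfl fun w _ => ?_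
        rw [avgCoeffY_eq_ite, hzs, hlev]
        split_ifs with hw
        exacts [rfl, by rw [zero_mul, mul_zero]]
    _ = levC d ℓ (aPrinted ℓ 1) s.1.1 * (Matrix.trace ((blkSumY i par U Φ s)ᴴ * blkSumY i par U Φ s)).re := by
        rw [← Finset.mul_sum, blkSumY, Matrix.conjTranspose_sum, Finset.sum_mul, Matrix.trace_sum, Complex.re_sum]
        congr 1
        refine Finset.sum_congr rfl fun z hz => ?_
        rw [Matrix.mul_sum, Matrix.trace_sum, Complex.re_sum]
        refine Finset.sum_congr rfl fun w hw => ?_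
        simp only [crnTrY, hmem.1 hz, hmem.1 hw]

/-- every block of `𝔅` has level `≥ 1`. [cite: Balaban1984PropagatorsII, (2.3)–(2.4) p.224, bookkeeping] -/
theorem one_le_level (s : BlkY i) : 1 ≤ s.1.1 := by
  obtain ⟨z, hz⟩ := exists_blkOf_eq i.D.toDomains s
  rw [← lev_eq_of_blkOf_eq i.D.toDomains hz]
  exact (toKT i).D.one_le_lev z.1

/-- the block coefficient `levC_s = a_j L^{−2j} L^{−j(d+1)}` is POSITIVE (`a_j > 0` along the printed sequence).
[cite: Balaban1984PropagatorsII, (2.14) p.225; Balaban1982Higgs1, (2.15) p.609] -/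
theorem levC_blk_pos (s : BlkY i) : 0 < levC d ℓ (aPrinted ℓ 1) s.1.1 :=
  levC_pos d ℓ (B6Prop23KLevelTorusCensus.aPrinted_pos (B9Cor35AtOneInverseLetters.one_le_ell i) _ (one_le_level i s))

/-- ★ **(3.24) AS PRINTED, AT def-Y's LETTER**: on an inverse-symmetric `G`-valued transporter table (`G ≤ U(N)`) and a `G`-valued configuration
`⟨Φ, Δ′_a(U)Φ⟩₁ = Σ_μ ‖∇_{U,μ}Φ‖²₁ + Σ_{s∈𝔅} levC_s·‖Σ_{z∈s}R(U(Γ_{c_s,z}))Φ(z)‖²_F`. [cite: Balaban1985BackgroundPropagators, (3.23)–(3.24) pp.394–395] -/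
theorem trIP_deltaPrimeAY_eq (hG : G ≤ B7Prop2Explicit.unitaryUnits (Matrix (Fin N) (Fin N) ℂ))
    (par : SiteParY (Matrix (Fin N) (Fin N) ℂ) i) (U : CfgY (Matrix (Fin N) (Fin N) ℂ) i) (hinv : ∀ z z' : SiteY i, par U z z' = (par U z' z)⁻¹)
    (hpar : ∀ z w : SiteY i, par U z w ∈ G) (hU : ∀ μ x, U μ x ∈ G) (Φ : SiteY i → Matrix (Fin N) (Fin N) ℂ) :
    trIP (fun _ => (1 : ℝ)) Φ (deltaPrimeAY i par U Φ)
      = (∑ μ : Fin (d + 1), trIP (fun _ => (1 : ℝ)) (cdS i U μ Φ) (cdS i U μ Φ))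
        + ∑ s : BlkY i, levC d ℓ (aPrinted ℓ 1) s.1.1 * (Matrix.trace ((blkSumY i par U Φ s)ᴴ * blkSumY i par U Φ s)).re := by
  rw [deltaPrimeAY, LinearMap.add_apply, trIP_add_right, trIP_lapSL_eq i U (fun μ x => hG (hU μ x)) Φ,
    trIP_kernelTrOpY_eq_sum_blk i hG par U hinv hpar Φ]

end Forms

/-! ## §3 `Δ′_a(U)` is positive definite; `G′(U) = Δ′_a(U)⁻¹` is positive definite -/

section Pos

open scoped Matrix.Norms.L2Operator

variable {d ℓ : ℕ} {hd : 1 ≤ d + 1} {hL : Odd (ℓ + 1) ∧ 1 < ℓ + 1} {b₀ b₁ : ℝ} {N : ℕ}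
variable (i : KIdx d ℓ hd hL b₀ b₁) {G : Subgroup (Matrix (Fin N) (Fin N) ℂ)ˣ}

/-- ★★ **Δ′_a(U) IS POSITIVE DEFINITE** on any inverse-symmetric `G`-valued transporter table that TRANSPORTS FLAT SECTIONS (`∇_UΦ = 0 ⇒
R(U(Γ_{z,w}))Φ(w) = Φ(z)`), `G ≤ U(N)`, at a `G`-valued configuration: the form (3.24) is a sum of squares, and its vanishing forces `∇_UΦ = 0` and
every transported block sum `= |s|·Φ(c_s)` to vanish, so `Φ = 0` at every block corner, so `Φ ≡ 0`.  No smallness of the field is used (print: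
*"Assuming some regularity of the configuration U it can be easily shown that the operator Δ′_a is positive"*).
[cite: Balaban1985BackgroundPropagators, (3.24) pp.394–395, Thm 3.11 p.416 («obvious for the first three operators»)] -/
theorem deltaPrimeAY_posDefTr_of_flat_transport (hG : G ≤ B7Prop2Explicit.unitaryUnits (Matrix (Fin N) (Fin N) ℂ))
    (par : SiteParY (Matrix (Fin N) (Fin N) ℂ) i) (U : CfgY (Matrix (Fin N) (Fin N) ℂ) i) (hinv : ∀ z z' : SiteY i, par U z z' = (par U z' z)⁻¹)
    (hpar : ∀ z w : SiteY i, par U z w ∈ G) (hU : ∀ μ x, U μ x ∈ G)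
    (htr : ∀ Φ : SiteY i → Matrix (Fin N) (Fin N) ℂ, (∀ μ, cdS i U μ Φ = 0) → ∀ z w : SiteY i, R (par U z w) (Φ w) = Φ z) :
    PosDefTr (fun _ => (1 : ℝ)) (deltaPrimeAY i par U) := by
  intro Φ hΦ
  have hl : ∀ μ, 0 ≤ trIP (fun _ => (1 : ℝ)) (cdS i U μ Φ) (cdS i U μ Φ) := fun μ => trIP_self_nonneg _ (fun _ => one_pos) _
  have ha : ∀ s : BlkY i, 0 ≤ levC d ℓ (aPrinted ℓ 1) s.1.1 * (Matrix.trace ((blkSumY i par U Φ s)ᴴ * blkSumY i par U Φ s)).re := fun s =>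
    mul_nonneg (levC_blk_pos i s).le (re_trace_conjTranspose_mul_self_nonneg _)
  have hlap := Finset.sum_nonneg fun μ (_ : μ ∈ Finset.univ) => hl μ
  have havg := Finset.sum_nonneg fun s (_ : s ∈ Finset.univ) => ha s
  rw [trIP_deltaPrimeAY_eq i hG par U hinv hpar hU Φ]
  refine (add_nonneg hlap havg).lt_of_ne fun h0 => hΦ ?_
  -- (i) `∇_UΦ = 0`; (ii) every transported block sum vanishes
  have hcd : ∀ μ, cdS i U μ Φ = 0 := fun μ => by
    by_contra hne
    have h := (Finset.sum_eq_zero_iff_of_nonneg fun μ _ => hl μ).1 (by linarith) μ (Finset.mem_univ μ)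
    exact (trIP_self_pos (fun _ : SiteY i => (1 : ℝ)) (fun _ => one_pos) hne).ne' h
  have hB : ∀ s, blkSumY i par U Φ s = 0 := fun s => by
    have h := (Finset.sum_eq_zero_iff_of_nonneg fun s _ => ha s).1 (by linarith) s (Finset.mem_univ s)
    exact eq_zero_of_re_trace_conjTranspose_mul_self_eq_zero ((mul_eq_zero.1 h).resolve_left (levC_blk_pos i s).ne')
  -- (iii) by flat transport each block sum is `|s| • Φ(c_s)`, so `Φ(c_s) = 0`
  have hcorner : ∀ s : BlkY i, Φ (blkCornerY i s) = 0 := by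
    intro s
    have hsum : blkSumY i par U Φ s
        = (((Finset.univ.filter (fun z : SiteY i => blkOf i.D.toDomains z = s)).card : ℕ) : ℂ) • Φ (blkCornerY i s) := by
      rw [blkSumY, Nat.cast_smul_eq_nsmul, ← Finset.sum_const]
      exact Finset.sum_congr rfl fun z _ => htr Φ hcd (blkCornerY i s) z
    rw [hB s] at hsum
    refine (smul_eq_zero.1 hsum.symm).resolve_left (Nat.cast_ne_zero.2 (Finset.card_ne_zero.2 ⟨blkCornerY i s, ?_⟩))
    rw [Finset.mem_filter]
    exact ⟨Finset.mem_univ _, blkOf_corner i.D.toDomains s⟩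
  -- (iv) transport back from the corner: `Φ ≡ 0`
  funext z
  have h := htr Φ hcd (blkCornerY i (blkOf i.D.toDomains z)) z
  rw [hcorner] at h
  have h' := congrArg (R (par U (blkCornerY i (blkOf i.D.toDomains z)) z)⁻¹) h
  rwa [R_inv_R, R_zero] at h'

/-- ★★★ **Δ′_a(U) AT def-Y's v4 LETTER IS POSITIVE DEFINITE FOR EVERY `G`-VALUED CONFIGURATION**, `G ≤ U(N)` (e.g. `G = SU(N)`: every background
of (3.35), and every other unitary one): `PosDefTr 1 (deltaPrimeAY i (parSymY i) U)` — the row-17 clause `pos0` at the letters of record, with NO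
smallness hypothesis. [cite: Balaban1985BackgroundPropagators, (3.24) pp.394–395, Thm 3.11 p.416] -/
theorem deltaPrimeAY_parSymY_posDefTr (hG : G ≤ B7Prop2Explicit.unitaryUnits (Matrix (Fin N) (Fin N) ℂ)) {U : CfgY (Matrix (Fin N) (Fin N) ℂ) i}
    (hU : ∀ μ x, U μ x ∈ G) : PosDefTr (fun _ => (1 : ℝ)) (deltaPrimeAY i (parSymY i) U) :=
  deltaPrimeAY_posDefTr_of_flat_transport i hG (parSymY i) U (parSymY_inv_symm U) (fun z w => parSymY_mem i hU z w) hU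
    fun _ hΦ z w => R_parSymY_of_cdS_eq_zero i U hΦ z w

/-- hence Δ′_a(U) is INVERTIBLE at every `G`-valued configuration: def-Y's `GpY i (parSymY i) U = Ring.inverse Δ′_a(U)` IS the two-sided inverse
`G′(U)` of (3.25) there (no Theorem 3.1 needed for the existence). [cite: Balaban1985BackgroundPropagators, (3.25) p.395 («G′ = (Δ′_a)⁻¹»)] -/
theorem isUnit_deltaPrimeAY_parSymY (hG : G ≤ B7Prop2Explicit.unitaryUnits (Matrix (Fin N) (Fin N) ℂ)) {U : CfgY (Matrix (Fin N) (Fin N) ℂ) i}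
    (hU : ∀ μ x, U μ x ∈ G) : IsUnit (deltaPrimeAY i (parSymY i) U) :=
  isUnit_of_posDefTr (deltaPrimeAY_parSymY_posDefTr i hG hU)

/-- the `Ring.inverse` of a positive definite operator is positive definite (`⟨Ψ, T⁻¹Ψ⟩ = ⟨T⁻¹Ψ, T T⁻¹Ψ⟩ > 0`).
[cite: Balaban1985BackgroundPropagators, p.395 («positivity of Δ′_a … implies positivity of the operators G′»)] -/
theorem posDefTr_ringInverse {S : Type} [Fintype S] {w : S → ℝ} {T : (S → Matrix (Fin N) (Fin N) ℂ) →ₗ[ℂ] (S → Matrix (Fin N) (Fin N) ℂ)}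
    (h : PosDefTr w T) : PosDefTr w (Ring.inverse T) := by
  intro Ψ hΨ
  have hT : IsUnit T := isUnit_of_posDefTr h
  have hTΦ : T (Ring.inverse T Ψ) = Ψ := apply_inverse_of_isUnit hT Ψ
  have hΦ : Ring.inverse T Ψ ≠ 0 := fun h0 => hΨ (by rw [← hTΦ, h0, map_zero])
  have key := h _ hΦ
  rw [hTΦ, trIP_comm] at key
  exact key

/-- ★ **THEOREM 3.11's SECOND OPERATOR: `G′(U) = Δ′_a(U)⁻¹` IS POSITIVE DEFINITE** at every `G`-valued configuration, `G ≤ U(N)` (def-Y's `GpY` over the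
v4 transporter). [cite: Balaban1985BackgroundPropagators, p.395, Thm 3.11 p.416] -/
theorem GpY_parSymY_posDefTr (hG : G ≤ B7Prop2Explicit.unitaryUnits (Matrix (Fin N) (Fin N) ℂ)) {U : CfgY (Matrix (Fin N) (Fin N) ℂ) i}
    (hU : ∀ μ x, U μ x ∈ G) : PosDefTr (fun _ => (1 : ℝ)) (GpY i (parSymY i) U) :=
  posDefTr_ringInverse (deltaPrimeAY_parSymY_posDefTr i hG hU)

end Pos

end

end Literature.MathematicalPhysics.QuantumFieldTheory.Balaban1983to89.B9Thm311DeltaPrimePos
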